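import Mathlib
import Summits.AtomisticToContinuum.HydrodynamicLimit.Theorems.ImplosionDichotomyDenseExcursionPackingAnalyticHierarchyCalculus

/-!
# The stiffening coefficients of the hierarchy of `Γ` in the jet of `M` (ordinary Faà di Bruno form)
# (crux `DenseExcursion`, stmt-AtomisticToContinuum-12586, line `packing-analytic-implosion`)

Helper file (`--supports stmt-AtomisticToContinuum-12586`, line lead a2, stub `stub_analyticPackingImplosion`).
The order-`k` hierarchy `(kμ − L)X_k = Src_k` (`packingHierarchy_order`, `…PackingAnalyticHierarchy`) carries the
stiffening law `M` through the Taylor coefficients `Mc c (x) = ∂_G^c[M(G e^{3x} s(G, x)³)](0, x)/c!` of the stiffening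
factor ALONG the family. Kernel-checked here (`familyCoeff_stiffening`, REGISTERED helper): for `M` ANALYTIC at `0`
(the stub's `M = stiffening F`, `analyticOnNhd_stiffening`) and `G ↦ s(G, x)` smooth at `0` with Taylor coefficients
`sc n`,

  `Mc c = Σ_{j ≤ c} m_j · e^{3jx} · [G^{c−j}] (Σ_n sc n Gⁿ)^{3j}`,   `m_j = M⁽ʲ⁾(0)/j!`,

(`[Gⁱ](·) = PowerSeries.coeff i`, powers in `ℝ⟦G⟧`), i.e. the ORDINARY (power-series) form of Faà di Bruno for
`M ∘ (G ↦ G e^{3x} s³)`: `Mc c` is a universal polynomial in `sc 0 = S, sc 1, …, sc (c−1)`, `e^{3x}` and the jet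
`m_1, …, m_c` of `M` (`Mc 0 = m_0 = M(0)`, `Mc 1 = m_1 e^{3x} S³`). With it every source `Src_k` of the hierarchy is an
explicit polynomial in the lower orders, and the majorant bookkeeping (`coeff_pow_mono`, `analytic_majorant`) applies
verbatim to the stiffening terms (`|Mc c| ≤ Σ_j |m_j| e^{3jx} [G^{c−j}](Σ |sc n| Gⁿ)^{3j}`).

Proof: Taylor's formula with the analytic remainder `M(t) = Σ_{j≤c} m_j tʲ + t^{c+1} ρ(t)`, `ρ = (dslope · 0)^{c+1} M`
analytic at `0` (`HasFPowerSeriesAt.has_fpower_series_iterate_dslope_fslope`); along `t = ψ(G) = G e^{3x} s³` the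
remainder is `G^{c+1} ×` (smooth), invisible to `∂_G^c` at `0`; the polynomial part goes through the Taylor-series
calculus of `…PackingAnalyticHierarchyCalculus` (`Σ`, products, powers, `G· ↦ X·`). NOT here: anything about `Γ`.
-/

noncomputable section

open Filter Set Finset PowerSeries
open scoped Topology ContDiff

namespace Summit.AtomisticToContinuum.HydrodynamicLimit.Theorems.PackingAnalyticImplosion

/-! ## Taylor's formula with the `dslope` remainder -/

/-- Taylor's formula at `0` with the iterated-`dslope` remainder (pure algebra, every function):
`f b = Σ_{j<n} bʲ · ((dslope · 0)^j f)(0) + bⁿ · ((dslope · 0)^n f)(b)`. [folklore] -/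
theorem taylor_iterate_dslope (f : ℝ → ℝ) (n : ℕ) (b : ℝ) :
    f b = (∑ j ∈ Finset.range n, b ^ j * (Function.swap dslope 0)^[j] f 0) +
      b ^ n * (Function.swap dslope 0)^[n] f b := by
  induction n with
  | zero => simp
  | succ n ih =>
    have hstep : (Function.swap dslope 0)^[n] f b =
        (Function.swap dslope 0)^[n] f 0 + b * (Function.swap dslope 0)^[n + 1] f b := by
      rw [Function.iterate_succ_apply']
      have h := sub_smul_dslope ((Function.swap dslope 0)^[n] f) 0 b
      simp only [sub_zero, smul_eq_mul] at h
      change _ = _ + b * dslope ((Function.swap dslope (0 : ℝ))^[n] f) 0 b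
      linarith
    rw [ih, Finset.sum_range_succ, hstep]
    ring

/-- The iterated `dslope`s of a function analytic at `0` are analytic at `0`, and their values at `0` are the Taylor
coefficients `M⁽ʲ⁾(0)/j!`. [folklore] -/
theorem iterate_dslope_analytic {M : ℝ → ℝ} (hM : AnalyticAt ℝ M 0) (j : ℕ) :
    AnalyticAt ℝ ((Function.swap dslope 0)^[j] M) 0 ∧
      (Function.swap dslope 0)^[j] M 0 = iteratedDeriv j M 0 / (j.factorial : ℝ) := by
  obtain ⟨p, hp⟩ := hM
  have hj := hp.has_fpower_series_iterate_dslope_fslope j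
  refine ⟨hj.analyticAt, ?_⟩
  -- value at `0` = `p.coeff j`
  have h0 : (Function.swap dslope 0)^[j] M 0 = p.coeff j := by
    rw [← hj.coeff_zero 1, ← FormalMultilinearSeries.coeff, FormalMultilinearSeries.coeff_iterate_fslope,
      zero_add]
  -- `p.coeff j = M⁽ʲ⁾(0)/j!`
  obtain ⟨ρ, hρ⟩ := hp
  have hfs := hρ.factorial_smul 1 j
  rw [← iteratedDeriv_eq_iteratedFDeriv] at hfs
  have hc : p j (fun _ => (1 : ℝ)) = p.coeff j := by
    rw [FormalMultilinearSeries.apply_eq_pow_smul_coeff, one_pow, one_smul]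
  rw [hc, nsmul_eq_mul] at hfs
  rw [h0, ← hfs]
  have hj0 : (j.factorial : ℝ) ≠ 0 := by positivity
  field_simp

/-! ## Taylor series of powers and finite sums -/

/-- Taylor coefficients of a power: `series (f^j) = (series f)^j`. [folklore] -/
theorem taylorSeries_fun_pow {f : ℝ → ℝ} (hf : ContDiffAt ℝ ∞ f 0) (j : ℕ) :
    PowerSeries.mk (fun n => iteratedDeriv n (fun G => f G ^ j) 0 / (n.factorial : ℝ)) =
      PowerSeries.mk (fun n => iteratedDeriv n f 0 / (n.factorial : ℝ)) ^ j := by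
  induction j with
  | zero => simpa using taylorSeries_const (1 : ℝ)
  | succ j ih =>
    have h := taylorSeries_mul (f := fun G => f G ^ j) (g := f) (by fun_prop) hf
    have e : ((fun G => f G ^ j) * f) = fun G => f G ^ (j + 1) := by
      funext G; simp [pow_succ]
    rw [e] at h
    rw [h, ih, pow_succ]

/-- Taylor coefficients of a finite sum of smooth functions. [folklore] -/
theorem taylorSeries_fun_sum {ι : Type*} (I : Finset ι) {f : ι → ℝ → ℝ} (hf : ∀ i ∈ I, ContDiffAt ℝ ∞ (f i) 0) :
    PowerSeries.mk (fun n => iteratedDeriv n (fun G => ∑ i ∈ I, f i G) 0 / (n.factorial : ℝ)) =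
      ∑ i ∈ I, PowerSeries.mk (fun n => iteratedDeriv n (f i) 0 / (n.factorial : ℝ)) := by
  ext n
  simp only [coeff_mk, map_sum]
  rw [iteratedDeriv_fun_sum (fun i hi => (hf i hi).of_le (by exact_mod_cast le_top)), Finset.sum_div]

/-- A function `G ↦ G^{k+1} · H(G)` with `H` smooth at `0` is invisible to `∂_G^k` at `0`. [folklore] -/
theorem iteratedDeriv_pow_succ_mul_zero {H : ℝ → ℝ} {k : ℕ} (hH : ContDiffAt ℝ ∞ H 0) :
    iteratedDeriv k (fun G => G ^ (k + 1) * H G) 0 = 0 := by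
  rw [iteratedDeriv_fun_mul (by fun_prop) (hH.of_le (by exact_mod_cast le_top))]
  refine Finset.sum_eq_zero fun i hi => ?_
  have hik : i ≠ k + 1 := by
    have := Finset.mem_range.mp hi; omega
  have hz : iteratedDeriv i (fun G : ℝ => G ^ (k + 1)) 0 = 0 := by
    rw [iteratedDeriv_fun_pow_zero]
    simp [hik]
  rw [hz]; ring

/-! ## The stiffening coefficients along the family -/

/-- **THE STIFFENING COEFFICIENTS OF THE HIERARCHY IN THE JET OF `M`** (registered helper
`familyCoeff_stiffening`): for `M` analytic at `0` and `G ↦ s(G, x)` smooth at `G = 0` with Taylor coefficients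
`sc n (x)`, the Taylor coefficients of `G ↦ M(G e^{3x} s(G, x)³)` at `0` are
`Mc c = Σ_{j ≤ c} (M⁽ʲ⁾(0)/j!) · (e^{3x})ʲ · [G^{c−j}] (Σ_n sc n Gⁿ)^{3j}`. [folklore] -/
theorem familyCoeff_stiffening :
    ∀ (M : ℝ → ℝ) (s : ℝ → ℝ → ℝ) (x : ℝ), AnalyticAt ℝ M 0 → ContDiffAt ℝ ∞ (fun G => s G x) 0 →
      ∀ (sc Mc : ℕ → ℝ → ℝ), (∀ i, sc i x = iteratedDeriv i (fun G => s G x) 0 / (i.factorial : ℝ)) →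
        (∀ i, Mc i x = iteratedDeriv i (fun G => M (G * Real.exp (3 * x) * s G x ^ 3)) 0 / (i.factorial : ℝ)) →
        ∀ c : ℕ, Mc c x = ∑ j ∈ Finset.range (c + 1), iteratedDeriv j M 0 / (j.factorial : ℝ) *
          Real.exp (3 * x) ^ j * PowerSeries.coeff (c - j) ((PowerSeries.mk fun n => sc n x) ^ (3 * j)) := by
  intro M s x hM hB sc Mc hsc hMc c
  -- Taylor's formula for `M` with analytic remainder of order `c + 1`
  set g : ℕ → ℝ → ℝ := fun j => (Function.swap dslope 0)^[j] M with hg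
  have hgA : ∀ j, AnalyticAt ℝ (g j) 0 := fun j => (iterate_dslope_analytic hM j).1
  have hg0 : ∀ j, g j 0 = iteratedDeriv j M 0 / (j.factorial : ℝ) := fun j => (iterate_dslope_analytic hM j).2
  have hT : ∀ t, M t = (∑ j ∈ Finset.range (c + 1), t ^ j * g j 0) + t ^ (c + 1) * g (c + 1) t :=
    fun t => taylor_iterate_dslope M (c + 1) t
  -- the inner map `ψ(G) = G e^{3x} s³ = G · (e^{3x} s³)`
  have hψ : ContDiffAt ℝ ∞ (fun G => G * Real.exp (3 * x) * s G x ^ 3) 0 :=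
    (contDiffAt_id.mul contDiffAt_const).mul (hB.pow 3)
  have hψ0 : (fun G => G * Real.exp (3 * x) * s G x ^ 3) 0 = 0 := by simp
  -- decomposition of the composite
  have hdec : (fun G => M (G * Real.exp (3 * x) * s G x ^ 3)) =
      fun G => (∑ j ∈ Finset.range (c + 1), (Real.exp (3 * x)) ^ j * g j 0 * (G * s G x ^ 3) ^ j) +
        G ^ (c + 1) * ((Real.exp (3 * x) * s G x ^ 3) ^ (c + 1) * g (c + 1) (G * Real.exp (3 * x) * s G x ^ 3)) := by
    funext G
    rw [hT (G * Real.exp (3 * x) * s G x ^ 3)]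
    congr 1
    · refine Finset.sum_congr rfl fun j _ => ?_
      ring
    · ring
  -- the remainder is invisible to `∂_G^c` at `0`
  have hrem : ContDiffAt ℝ ∞ (fun G => (Real.exp (3 * x) * s G x ^ 3) ^ (c + 1) *
      g (c + 1) (G * Real.exp (3 * x) * s G x ^ 3)) 0 := by
    have h1 : ContDiffAt ℝ ∞ (g (c + 1)) ((fun G => G * Real.exp (3 * x) * s G x ^ 3) 0) := by
      rw [hψ0]; exact (hgA (c + 1)).contDiffAt
    exact ((contDiffAt_const.mul (hB.pow 3)).pow _).mul (h1.comp 0 hψ)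
  have hpoly : ContDiffAt ℝ ∞ (fun G => ∑ j ∈ Finset.range (c + 1),
      (Real.exp (3 * x)) ^ j * g j 0 * (G * s G x ^ 3) ^ j) 0 := by
    exact ContDiffAt.sum fun j _ => contDiffAt_const.mul ((contDiffAt_id.mul (hB.pow 3)).pow j)
  have hsplit : iteratedDeriv c (fun G => M (G * Real.exp (3 * x) * s G x ^ 3)) 0 =
      iteratedDeriv c (fun G => ∑ j ∈ Finset.range (c + 1),
        (Real.exp (3 * x)) ^ j * g j 0 * (G * s G x ^ 3) ^ j) 0 := by
    rw [hdec, iteratedDeriv_fun_add (hpoly.of_le (by exact_mod_cast le_top)) (by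
      exact ((contDiffAt_id.pow _).mul hrem).of_le (by exact_mod_cast le_top)),
      iteratedDeriv_pow_succ_mul_zero hrem, add_zero]
  -- Taylor series of the polynomial part
  have eB : PowerSeries.mk (fun n => iteratedDeriv n (fun G => s G x) 0 / (n.factorial : ℝ)) =
      PowerSeries.mk (fun n => sc n x) := by
    ext n; simp [coeff_mk, hsc]
  have hseries : PowerSeries.mk (fun n => iteratedDeriv n (fun G => ∑ j ∈ Finset.range (c + 1),
        (Real.exp (3 * x)) ^ j * g j 0 * (G * s G x ^ 3) ^ j) 0 / (n.factorial : ℝ)) =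
      ∑ j ∈ Finset.range (c + 1), PowerSeries.C ((Real.exp (3 * x)) ^ j * g j 0) *
        (PowerSeries.X * (PowerSeries.mk fun n => sc n x) ^ 3) ^ j := by
    rw [taylorSeries_fun_sum (f := fun j G => (Real.exp (3 * x)) ^ j * g j 0 * (G * s G x ^ 3) ^ j)
      (Finset.range (c + 1)) (fun j _ => contDiffAt_const.mul ((contDiffAt_id.mul (hB.pow 3)).pow j))]
    refine Finset.sum_congr rfl fun j _ => ?_
    rw [taylorSeries_const_mul (f := fun G => (G * s G x ^ 3) ^ j) ((contDiffAt_id.mul (hB.pow 3)).pow j),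
      taylorSeries_fun_pow (f := fun G => G * s G x ^ 3) (contDiffAt_id.mul (hB.pow 3)),
      taylorSeries_id_mul (f := fun G => s G x ^ 3) (hB.pow 3), taylorSeries_fun_pow hB 3, eB]
  -- read off the coefficient `c`
  rw [hMc c, hsplit]
  have hcoeff := congrArg (PowerSeries.coeff c) hseries
  rw [coeff_mk] at hcoeff
  rw [hcoeff, map_sum]
  refine Finset.sum_congr rfl fun j hj => ?_
  have hjc : j ≤ c := Nat.lt_succ_iff.mp (Finset.mem_range.mp hj)
  rw [coeff_C_mul, mul_pow, ← pow_mul, coeff_X_pow_mul', if_pos hjc, hg0 j, mul_comm 3 j]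
  ring

end Summit.AtomisticToContinuum.HydrodynamicLimit.Theorems.PackingAnalyticImplosion

end
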